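import Mathlib.Analysis.SpecialFunctions.Pow.Real
import Mathlib.Algebra.BigOperators.Field
import HarnessLib

/-!
# The scalar resummation of the Bogoliubov constants (BCS 2021, p. 11–13), quasi-free part

Topic `Literature/MathematicalPhysics/QuantumManyBody`; pure real bookkeeping for the provefact
`Literature.MathematicalPhysics.QuantumManyBody.BoseGas.BastiCenatiempoSchlein2021_upperBound`.

Abstract data on a finite set of modes `ι` with a condensate mode `z` and a set `P_L ∌ z` of low
modes (`L^c = ι ∖ (P_L ∪ {z})`): kinetic weights `ε`, pair potential values `W_p = W(e p)`,
`Wd p q = W(e p - e q)`, the scattering amplitudes `η` (`η_z = 0`) satisfying the **exact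
scattering equation** `ε_pη_p + ½ρ̃W_p + (2L³)⁻¹∑_q Wd(p,q)η_q = 0` for `p ≠ z`
(`TorusGalerkinScattering.galerkin_euler_lagrange` with `η = -Nc`), Bogoliubov data `σ² = sg2`,
`γσ = gs` vanishing at `z`, `N₀ ≥ 0`, `S = ∑σ²`, `N = N₀ + S`, `ρ̃ = N/L³`,
`ĝ_p = W_p + N⁻¹∑_q Wd(p,q)η_q`.

* `quasiFree_identity`: the quasi-free part of the trial functional per unit norm,
  `∑εσ² + [W(0)(N₀+S)² + 2N₀∑W(σ²+γσ) + ∑∑Wd(γσγσ' + σ²σ'²)]/(2L³)`, equals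
  `(N/2)ρ̃ĝ₀ + ∑_{P_L}[εσ² + (σ²+γσ)ρ̃ĝ_v] - ½ρ̃∑_{P_L}ĝ_vη_v - X + R`, where
  `X = (S/L³)∑_{L^c}Wη + L⁻³∑_{P_L}σ_v²∑_{L^c}Wd(r,v)η_r` is the part cancelled by the cubic vector
  and `R` an explicit list of remainder sums ((const1)–(const4) of [BastiCenatiempoSchlein2021] with
  `ℰ₂ = ℰ₃ = 0`).

## References

* [BastiCenatiempoSchlein2021] G. Basti, S. Cenatiempo, B. Schlein, Forum Math. Sigma 9 (2021) e74,
  arXiv:2101.06222: §3, (const1)–(const4), p. 11–13.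
-/

noncomputable section

namespace Literature.MathematicalPhysics.QuantumManyBody.BoseGas

open Finset
open scoped BigOperators

namespace ScalarResummation

variable {ι : Type*} [Fintype ι] [DecidableEq ι]

/-- Splitting a sum over the modes into the condensate, the low set and the rest. [folklore] -/
theorem sum_split (z : ι) (PL : Finset ι) (hz : z ∉ PL) (f : ι → ℝ) :
    ∑ p, f p = f z + ∑ p ∈ PL, f p + ∑ p ∈ (Finset.univ \ insert z PL), f p := by
  have h1 : (Finset.univ : Finset ι) = insert z PL ∪ (Finset.univ \ insert z PL) := by
    rw [Finset.union_sdiff_of_subset (Finset.subset_univ _)]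
  conv_lhs => rw [h1]
  rw [Finset.sum_union Finset.disjoint_sdiff, Finset.sum_insert hz]

/-- Splitting a double sum (both indices) when the summand vanishes at the condensate.
[folklore] -/
theorem sum_sum_split (z : ι) (PL : Finset ι) (hz : z ∉ PL) (F : ι → ι → ℝ)
    (hz1 : ∀ q, F z q = 0) (hz2 : ∀ p, F p z = 0) :
    ∑ p, ∑ q, F p q =
      (∑ p ∈ PL, ∑ q ∈ PL, F p q) + (∑ p ∈ PL, ∑ q ∈ (Finset.univ \ insert z PL), F p q) +
      (∑ p ∈ (Finset.univ \ insert z PL), ∑ q ∈ PL, F p q) +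
      (∑ p ∈ (Finset.univ \ insert z PL), ∑ q ∈ (Finset.univ \ insert z PL), F p q) := by
  rw [sum_split z PL hz]
  simp only [hz1, Finset.sum_const_zero, zero_add]
  have hin : ∀ p, ∑ q, F p q = ∑ q ∈ PL, F p q + ∑ q ∈ (Finset.univ \ insert z PL), F p q := by
    intro p; rw [sum_split z PL hz, hz2, zero_add]
  simp only [hin, Finset.sum_add_distrib]
  ring

variable {z : ι} {PL : Finset ι} {ε W η sg2 gs : ι → ℝ} {Wd : ι → ι → ℝ} {N₀ L : ℝ}

/-- **The quasi-free part of the trial functional, regrouped** ((const1)–(const4) of [ibid.] with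
the exact scattering equation, `ℰ₂ = ℰ₃ = 0`). Notation: `Lc = ι ∖ (P_L ∪ {z})`, `S = ∑σ²`,
`N = N₀ + S`, `ρ̃ = N/L³`, `ĝ_p = W_p + N⁻¹∑_q Wd(p,q)η_q`, `e3 = γσ - η`, `e4 = σ² - η²` (used on
`Lc`). Then
`∑εσ² + [W₀(N₀+S)² + 2N₀∑W(σ²+γσ) + ∑∑Wd(γσγσ' + σ²σ'²)]/(2L³)`
`= (N/2)ρ̃ĝ_z + ∑_{P_L}[εσ² + (σ²+γσ)ρ̃ĝ] - (ρ̃/2)∑_{P_L}ĝη - X + R`,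
`X = (S/L³)∑_{Lc}Wη + L⁻³∑_{v∈P_L}σ_v²∑_{r∈Lc}Wd(v,r)η_r` (cancelled later by the cubic vector) and
`R` the explicit remainder in the statement (terms in `e3, e4` over `Lc`, `σ_L`–`η_L` products over
`P_L × P_L`, `(S/L³)∑_{P_L}W(σ²+γσ)`, and the `σ²σ'²` convolution).
[cite: BastiCenatiempoSchlein2021, (const1), (const2), (const2-step1), (const4), p. 11–12] -/
theorem quasiFree_identity (hz : z ∉ PL) (hL : 0 < L) (hN : 0 < N₀ + ∑ p, sg2 p)
    (hWd_symm : ∀ p q, Wd p q = Wd q p) (hWd_z : ∀ q, Wd z q = W q)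
    (hηz : η z = 0) (hsg2z : sg2 z = 0) (hgsz : gs z = 0)
    (hEL : ∀ p, p ≠ z → ε p * η p + (N₀ + ∑ q, sg2 q) / L ^ 3 / 2 * W p +
      (2 * L ^ 3)⁻¹ * ∑ q, Wd p q * η q = 0) :
    (∑ p, ε p * sg2 p) +
      (Wd z z * (N₀ + ∑ p, sg2 p) ^ 2 + 2 * N₀ * ∑ p, W p * (sg2 p + gs p) +
        ∑ p, ∑ q, Wd p q * (gs p * gs q + sg2 p * sg2 q)) / (2 * L ^ 3) =
      -- main terms
      (N₀ + ∑ p, sg2 p) / 2 * ((N₀ + ∑ p, sg2 p) / L ^ 3) *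
          (W z + (N₀ + ∑ p, sg2 p)⁻¹ * ∑ q, Wd z q * η q) +
        (∑ v ∈ PL, (ε v * sg2 v + (sg2 v + gs v) * ((N₀ + ∑ p, sg2 p) / L ^ 3 *
          (W v + (N₀ + ∑ p, sg2 p)⁻¹ * ∑ q, Wd v q * η q)))) -
        (N₀ + ∑ p, sg2 p) / L ^ 3 / 2 * ∑ v ∈ PL, (W v + (N₀ + ∑ p, sg2 p)⁻¹ * ∑ q, Wd v q * η q) * η v -
      -- the part cancelled by the cubic vector
      ((∑ p, sg2 p) / L ^ 3 * ∑ p ∈ (Finset.univ \ insert z PL), W p * η p +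
        (L ^ 3)⁻¹ * ∑ v ∈ PL, sg2 v * ∑ r ∈ (Finset.univ \ insert z PL), Wd v r * η r) +
      -- remainder
      ((∑ p ∈ (Finset.univ \ insert z PL), ε p * (sg2 p - η p ^ 2)) +
        N₀ / L ^ 3 * ∑ p ∈ (Finset.univ \ insert z PL), W p * (η p ^ 2 + (sg2 p - η p ^ 2) + (gs p - η p)) +
        (2 * L ^ 3)⁻¹ * ∑ p ∈ PL, ∑ q ∈ PL, Wd p q * (gs p * gs q) +
        (L ^ 3)⁻¹ * ∑ v ∈ PL, gs v * ∑ p ∈ (Finset.univ \ insert z PL), Wd v p * (gs p - η p) +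
        (2 * L ^ 3)⁻¹ * ∑ p ∈ (Finset.univ \ insert z PL), ∑ q ∈ (Finset.univ \ insert z PL),
          Wd p q * ((gs p - η p) * η q + η p * (gs q - η q) + (gs p - η p) * (gs q - η q)) +
        (∑ p, ∑ q, Wd p q * (sg2 p * sg2 q)) / (2 * L ^ 3) -
        (∑ p, sg2 p) / L ^ 3 * ∑ v ∈ PL, W v * (sg2 v + gs v) -
        (L ^ 3)⁻¹ * ∑ v ∈ PL, (sg2 v + gs v) * ∑ q ∈ PL, Wd v q * η q +
        (2 * L ^ 3)⁻¹ * ∑ v ∈ PL, η v * ∑ q ∈ PL, Wd v q * η q) := by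
  set Lc := (Finset.univ \ insert z PL) with hLc
  set S := ∑ p, sg2 p with hS
  set N := N₀ + S with hNdef
  have hN0 : N ≠ 0 := hN.ne'
  have hL3 : L ^ 3 ≠ 0 := by positivity
  have hmemLc : ∀ {p}, p ∈ Lc → p ≠ z := by
    intro p hp h; rw [hLc, Finset.mem_sdiff] at hp; exact hp.2 (h ▸ Finset.mem_insert_self z PL)
  -- atomic sums
  set B1 := ∑ p ∈ Lc, W p * η p with hB1
  set B2 := ∑ p ∈ PL, W p * η p with hB2
  set K1 := ∑ v ∈ PL, ε v * sg2 v with hK1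
  set K2 := ∑ p ∈ Lc, ε p * η p ^ 2 with hK2
  set K3 := ∑ p ∈ Lc, ε p * (sg2 p - η p ^ 2) with hK3
  set C1 := ∑ v ∈ PL, W v * (sg2 v + gs v) with hC1
  set C2 := ∑ p ∈ Lc, W p * (η p ^ 2 + (sg2 p - η p ^ 2) + (gs p - η p)) with hC2
  set A1 := ∑ v ∈ PL, gs v * ∑ q ∈ Lc, Wd v q * η q with hA1
  set A2 := ∑ v ∈ PL, sg2 v * ∑ q ∈ Lc, Wd v q * η q with hA2
  set A3 := ∑ v ∈ PL, η v * ∑ q ∈ Lc, Wd v q * η q with hA3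
  set A4 := ∑ v ∈ PL, η v * ∑ q ∈ PL, Wd v q * η q with hA4
  set A5 := ∑ v ∈ PL, (sg2 v + gs v) * ∑ q ∈ PL, Wd v q * η q with hA5
  set A6 := ∑ p ∈ PL, ∑ q ∈ PL, Wd p q * (gs p * gs q) with hA6
  set A7 := ∑ v ∈ PL, gs v * ∑ p ∈ Lc, Wd v p * (gs p - η p) with hA7
  set A8 := ∑ p ∈ Lc, η p * ∑ q ∈ Lc, Wd p q * η q with hA8
  set A9 := ∑ p ∈ Lc, ∑ q ∈ Lc, Wd p q * ((gs p - η p) * η q + η p * (gs q - η q) + (gs p - η p) * (gs q - η q))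
    with hA9
  set D := ∑ p, ∑ q, Wd p q * (sg2 p * sg2 q) with hD
  -- (K) kinetic
  have hK : ∑ p, ε p * sg2 p = K1 + K2 + K3 := by
    rw [sum_split z PL hz, hsg2z, mul_zero, zero_add, ← hLc, hK1, hK2, hK3, add_assoc, ← Finset.sum_add_distrib]
    congr 1
    exact Finset.sum_congr rfl fun p _ => by ring
  -- (C1)
  have hC : ∑ p, W p * (sg2 p + gs p) = C1 + B1 + C2 := by
    rw [sum_split z PL hz, hsg2z, hgsz, add_zero, mul_zero, zero_add, ← hLc, hC1, hB1, hC2, add_assoc,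
      ← Finset.sum_add_distrib]
    congr 1
    exact Finset.sum_congr rfl fun p _ => by ring
  -- (C2) the `γσ γσ'` convolution
  have hGG : ∑ p, ∑ q, Wd p q * (gs p * gs q) = A6 + 2 * (A1 + A7) + (A8 + A9) := by
    rw [sum_sum_split z PL hz (fun p q => Wd p q * (gs p * gs q)) (fun q => by simp [hgsz]) (fun p => by simp [hgsz]),
      ← hLc, ← hA6]
    have h12 : ∑ p ∈ PL, ∑ q ∈ Lc, Wd p q * (gs p * gs q) = A1 + A7 := by
      rw [hA1, hA7, ← Finset.sum_add_distrib]
      refine Finset.sum_congr rfl fun v _ => ?_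
      rw [Finset.mul_sum, Finset.mul_sum, ← Finset.sum_add_distrib]
      exact Finset.sum_congr rfl fun q _ => by ring
    have h21 : ∑ p ∈ Lc, ∑ q ∈ PL, Wd p q * (gs p * gs q) = A1 + A7 := by
      rw [Finset.sum_comm, ← h12]
      refine Finset.sum_congr rfl fun v _ => Finset.sum_congr rfl fun q _ => ?_
      rw [hWd_symm]; ring
    have h22 : ∑ p ∈ Lc, ∑ q ∈ Lc, Wd p q * (gs p * gs q) = A8 + A9 := by
      rw [hA8, hA9, ← Finset.sum_add_distrib]
      refine Finset.sum_congr rfl fun p _ => ?_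
      rw [Finset.mul_sum, ← Finset.sum_add_distrib]
      exact Finset.sum_congr rfl fun q _ => by ring
    rw [h12, h21, h22]; ring
  -- inner sums split
  have hgv : ∀ v, ∑ q, Wd v q * η q = ∑ q ∈ PL, Wd v q * η q + ∑ q ∈ Lc, Wd v q * η q := by
    intro v; rw [sum_split z PL hz, hηz, mul_zero, zero_add]
  -- (B) the scattering equation summed against `η` over `Lc`
  have hB : K2 = -((N / L ^ 3) / 2) * B1 - (2 * L ^ 3)⁻¹ * (A3 + A8) := by
    have hA3' : A3 = ∑ p ∈ Lc, η p * ∑ q ∈ PL, Wd p q * η q := by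
      rw [hA3]
      simp only [Finset.mul_sum]
      rw [Finset.sum_comm]
      refine Finset.sum_congr rfl fun p _ => Finset.sum_congr rfl fun q _ => ?_
      rw [hWd_symm]; ring
    have hpt : ∀ p ∈ Lc, ε p * η p ^ 2 = -((N / L ^ 3) / 2) * (W p * η p) -
        (2 * L ^ 3)⁻¹ * (η p * ∑ q ∈ PL, Wd p q * η q + η p * ∑ q ∈ Lc, Wd p q * η q) := by
      intro p hp
      have h := hEL p (hmemLc hp)
      rw [hgv p] at h
      linear_combination (η p) * h
    rw [hK2, Finset.sum_congr rfl hpt, Finset.sum_sub_distrib, ← Finset.mul_sum, ← Finset.mul_sum,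
      Finset.sum_add_distrib, hB1, hA3', hA8]
  -- the `ĝ`-expansions
  have hgz : W z + N⁻¹ * ∑ q, Wd z q * η q = W z + N⁻¹ * (B2 + B1) := by
    rw [sum_split z PL hz, hηz, mul_zero, zero_add, ← hLc, hB2, hB1]
    congr 2
    congr 1 <;> exact Finset.sum_congr rfl fun q _ => by rw [hWd_z]
  have hM1 : ∑ v ∈ PL, (ε v * sg2 v + (sg2 v + gs v) * (N / L ^ 3 * (W v + N⁻¹ * ∑ q, Wd v q * η q))) =
      K1 + N / L ^ 3 * C1 + (L ^ 3)⁻¹ * (A5 + (A2 + A1)) := by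
    have hpt : ∀ v ∈ PL, ε v * sg2 v + (sg2 v + gs v) * (N / L ^ 3 * (W v + N⁻¹ * ∑ q, Wd v q * η q)) =
        ε v * sg2 v + N / L ^ 3 * (W v * (sg2 v + gs v)) +
        (L ^ 3)⁻¹ * ((sg2 v + gs v) * ∑ q ∈ PL, Wd v q * η q +
          (sg2 v * ∑ q ∈ Lc, Wd v q * η q + gs v * ∑ q ∈ Lc, Wd v q * η q)) := by
      intro v _
      rw [hgv v]
      field_simp
      ring
    rw [Finset.sum_congr rfl hpt, Finset.sum_add_distrib, Finset.sum_add_distrib, ← Finset.mul_sum, ← Finset.mul_sum,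
      Finset.sum_add_distrib, Finset.sum_add_distrib, hK1, hC1, hA5, hA2, hA1]
  have hM2 : ∑ v ∈ PL, (W v + N⁻¹ * ∑ q, Wd v q * η q) * η v = B2 + N⁻¹ * (A4 + A3) := by
    have hpt : ∀ v ∈ PL, (W v + N⁻¹ * ∑ q, Wd v q * η q) * η v =
        W v * η v + N⁻¹ * (η v * ∑ q ∈ PL, Wd v q * η q + η v * ∑ q ∈ Lc, Wd v q * η q) := by
      intro v _
      rw [hgv v]; ring
    rw [Finset.sum_congr rfl hpt, Finset.sum_add_distrib, ← Finset.mul_sum, Finset.sum_add_distrib, hB2, hA4, hA3]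
  -- the full convolution
  have hconv : ∑ p, ∑ q, Wd p q * (gs p * gs q + sg2 p * sg2 q) = (A6 + 2 * (A1 + A7) + (A8 + A9)) + D := by
    rw [← hGG, hD, ← Finset.sum_add_distrib]
    refine Finset.sum_congr rfl fun p _ => ?_
    rw [← Finset.sum_add_distrib]
    exact Finset.sum_congr rfl fun q _ => by ring
  -- assemble
  have hNS : N₀ + S ≠ 0 := by rw [← hNdef]; exact hN0
  rw [hK, hC, hconv, hgz, hM1, hM2, hB, hWd_z z, hNdef]
  field_simp
  ring

omit [DecidableEq ι] in
/-- **The low-momentum linear term via the scattering equation**: for `v ∈ P_L` (`v ≠ z`,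
`ε_v > 0`) the exact equation gives `η_v = -ρ̃ĝ_v/(2ε_v)`, hence
`-(ρ̃/2)∑_{P_L} ĝ_vη_v = ∑_{P_L} (ρ̃ĝ_v)²/(4ε_v)` — the term `(8π𝔞N^κ)²/(4v²)` of [ibid., (const5)],
here without error. [cite: BastiCenatiempoSchlein2021, p. 13 (display before "Thus")] -/
theorem lowMomentum_linear (hz : z ∉ PL) (hL : 0 < L) (hN : 0 < N₀ + ∑ p, sg2 p)
    (hεL : ∀ v ∈ PL, 0 < ε v)
    (hEL : ∀ p, p ≠ z → ε p * η p + (N₀ + ∑ q, sg2 q) / L ^ 3 / 2 * W p +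
      (2 * L ^ 3)⁻¹ * ∑ q, Wd p q * η q = 0) :
    -((N₀ + ∑ p, sg2 p) / L ^ 3 / 2 * ∑ v ∈ PL, (W v + (N₀ + ∑ p, sg2 p)⁻¹ * ∑ q, Wd v q * η q) * η v) =
      ∑ v ∈ PL, ((N₀ + ∑ p, sg2 p) / L ^ 3 * (W v + (N₀ + ∑ p, sg2 p)⁻¹ * ∑ q, Wd v q * η q)) ^ 2 / (4 * ε v) := by
  set N := N₀ + ∑ p, sg2 p with hNdef
  have hN0 : N ≠ 0 := hN.ne'
  have hL3 : (L ^ 3) ≠ 0 := by positivity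
  rw [Finset.mul_sum, ← Finset.sum_neg_distrib]
  refine Finset.sum_congr rfl fun v hv => ?_
  have hvz : v ≠ z := fun h => hz (h ▸ hv)
  have hε := hεL v hv
  have h := hEL v hvz
  -- `η_v = -ρ̃ĝ_v/(2ε_v)`
  have hη : η v = -(N / L ^ 3 * (W v + N⁻¹ * ∑ q, Wd v q * η q)) / (2 * ε v) := by
    field_simp
    field_simp at h
    linear_combination h
  rw [hη]
  field_simp
  ring

omit [Fintype ι] [DecidableEq ι] in
/-- **The low-momentum Bogoliubov sum, resummed** (the `(eq:sL2)`/p. 13 step): if on `P_L` the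
Bogoliubov data are `σ_v² = (ε_v + g - R_v)/(2R_v)`, `γ_vσ_v = -g/(2R_v)`, `R_v = √(ε_v²+2gε_v)`, then
for any `G : ι → ℝ`,
`∑_{P_L}[ε_vσ_v² + (σ_v²+γ_vσ_v)G_v] = ½∑_{P_L}[R_v - ε_v - g] + ½∑_{P_L}(G_v - g)(ε_v/R_v - 1)`
(the second sum is `ℰ₄`). [cite: BastiCenatiempoSchlein2021, p. 13 (the display defining `ℰ₄`)] -/
theorem lowMomentum_resummation {g : ℝ} (hg : 0 ≤ g) (hεL : ∀ v ∈ PL, 0 < ε v) (G : ι → ℝ)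
    (hsg2 : ∀ v ∈ PL, sg2 v = (ε v + g - Real.sqrt (ε v ^ 2 + 2 * g * ε v)) / (2 * Real.sqrt (ε v ^ 2 + 2 * g * ε v)))
    (hgs : ∀ v ∈ PL, gs v = -g / (2 * Real.sqrt (ε v ^ 2 + 2 * g * ε v))) :
    ∑ v ∈ PL, (ε v * sg2 v + (sg2 v + gs v) * G v) =
      (∑ v ∈ PL, (Real.sqrt (ε v ^ 2 + 2 * g * ε v) - ε v - g)) / 2 +
        (∑ v ∈ PL, (G v - g) * (ε v / Real.sqrt (ε v ^ 2 + 2 * g * ε v) - 1)) / 2 := by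
  rw [Finset.sum_div, Finset.sum_div, ← Finset.sum_add_distrib]
  refine Finset.sum_congr rfl fun v hv => ?_
  have hε := hεL v hv
  have hR : 0 < Real.sqrt (ε v ^ 2 + 2 * g * ε v) := Real.sqrt_pos.2 (by positivity)
  have hR2 : Real.sqrt (ε v ^ 2 + 2 * g * ε v) ^ 2 = ε v ^ 2 + 2 * g * ε v := Real.sq_sqrt (by positivity)
  rw [hsg2 v hv, hgs v hv]
  set R := Real.sqrt (ε v ^ 2 + 2 * g * ε v) with hRdef
  field_simp
  nlinarith [hR2]

end ScalarResummation

end Literature.MathematicalPhysics.QuantumManyBody.BoseGas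

end
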